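import Summits.Ventures.Crystal3D.Bulk.CapX2Sound
import HarnessLib

/-!
# Banded (occupancy) accounting, part 1: the rearrangement identity + positivity for ARBITRARY band labellings

HONEST FRAMING. Part of the venture `Summits/Ventures/Crystal3D` (cell `pub-crystal3d`, phase 2, decision sprint).
Mathematics and Lean text by seat theory-1 (g7) (scratch `HOME/lean/occframe/spec/BandedAccounting.scratch.lean.txt`,
sha256:16 `5a20ba3435f60bb9`, farm rc 0 / 0 sorry / standard axioms), LANDED UNCHANGED (statements and proofs byte-identical,
split into two files for the 400-line limit) by seat p1 (g7) under lead g7 RULING #4 (g7) (1)(b) as LANE-INDEPENDENT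
INFRASTRUCTURE: the occupancy analogue of `Bulk/CapX2Sound.lean` (`CapX2.accounting`, `poleBlock_nonneg`). It is the
«K2BB / banded soundness in Lean» half of `HOME/lean/occframe/spec/OCC-SOCKET-SPEC.md`; it CERTIFIES NOTHING about any level
(no certificate is read here), and the occupancy GLUE (`OccFrame`, `OccCut …`) is NOT in the tree (lead RULING #132 (c): after
a box 1 only).

Content (namespace `Summit.Ventures.Crystal3D.BandedSpec`, theory-1's): for a finite set `C` of unit vectors, a pole
`e` (hole centre `p = -e`), an ARBITRARY labelling `lab : E³ → Fin K` («bands»; no relation between labels and latitudes is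
used here — that enters only through the DOMAINS of the piece bounds in part 2), a cap kernel `Kp` and pole families
`S : Fin K → Option (Fin K) → Option (Fin K) → (ℝ → ℝ → ℝ → ℝ)` (family index = label of the POLE; block index `none` = the
hole-centre column):
* the pole-`x` READINGS `readD` (one point), `readPh` (ordered pair), `readT` (ordered triple);
* `banded_accounting` **(A)**: cap positivity + per-pole block positivity ⇒
  `0 ≤ Σ_x readD + Σ_{x ≠ y} readPh + Σ_{x,y,z distinct} readT`;
* `pair_multiplicity` **(C, pairs)**: `Σ_{x ≠ y} c (lab x) (lab y) = Σ_{p,q} (n_p n_q − [p = q] n_p) c p q`;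
* `banded_poleBlock_nonneg`: the per-pole block positivity for FACTORED PSD data with label-dependent weights
  (`CapX2Sound.poleBlock_nonneg`'s proof on `insertNone C`; `sum_sum_Q3_nonneg` takes arbitrary weights);
* `banded_accounting_factored`: the HYPOTHESIS-FREE corollary for `Kp := capKernel3 Kc Rc g` and
  `S b β β' := poleKernel3 Kq R (a b β) (a b β')`, `p = -e`.
Part 2 (`Bulk/BandedAccountingSound.lean`): triple multiplicities, the bound functional `Φ`, and the abstract soundness
`occupancy_certificate_sound` ((B) piece bounds + `Φ(bandCount) < 0` ⇒ `False`).
-/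

open Finset
open scoped InnerProductSpace BigOperators

namespace Summit.Ventures.Crystal3D.BandedSpec

variable {K : ℕ}

/-- pole-`x` ONE-POINT reading `D`. -/
noncomputable def readD (Kp : ℝ → ℝ → ℝ → ℝ) (S : Fin K → Option (Fin K) → Option (Fin K) → ℝ → ℝ → ℝ → ℝ)
    (b : Fin K) (u : ℝ) : ℝ :=
  Kp u u 1 + S b (some b) (some b) 1 1 1 + S b (some b) none 1 (-u) (-u)
    + S b none (some b) (-u) 1 (-u) + S b none none (-u) (-u) 1

/-- pole-`x` PAIR reading `Ph` (x in band `bx` at latitude `u`, y in band `by_` at `v`, `t = ⟪x,y⟫`);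
the certificate's pair piece is `2 P_{pq}(u,v,t) = readPh p q u v t + readPh q p v u t`. -/
noncomputable def readPh (Kp : ℝ → ℝ → ℝ → ℝ) (S : Fin K → Option (Fin K) → Option (Fin K) → ℝ → ℝ → ℝ → ℝ)
    (bx by_ : Fin K) (u v t : ℝ) : ℝ :=
  Kp u v t + S bx (some bx) (some by_) 1 t t + S bx (some by_) (some bx) t 1 t
    + S bx (some by_) (some by_) t t 1 + S bx (some by_) none t (-u) (-v) + S bx none (some by_) (-u) t (-v)

/-- pole-`x` TRIPLE reading `T` (`a = ⟪x,y⟫, b = ⟪x,z⟫, c = ⟪y,z⟫`); the certificate's triple piece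
`S_τ(a,b,c)` is the sum of the six orderings. -/
noncomputable def readT (S : Fin K → Option (Fin K) → Option (Fin K) → ℝ → ℝ → ℝ → ℝ)
    (bx by_ bz : Fin K) (a b c : ℝ) : ℝ :=
  S bx (some by_) (some bz) a b c

/-- **(A) Banded rearrangement + positivity.**  For ANY labelling `lab`, the cap positivity `hK`
and the per-pole block positivity `hblock` (aggregated X2 validity with `S = C ∪ {p}`, `⟪x,p⟫ = -u_x`,
`⟪p,p⟫ = 1`) give `0 ≤ Σ D + Σ_{x≠y} Ph + Σ_{x,y,z distinct} T`. -/
theorem banded_accounting (e : (EuclideanSpace ℝ (Fin 3))) (C : Finset (EuclideanSpace ℝ (Fin 3))) (hC : ∀ x ∈ C, ‖x‖ = 1)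
    (lab : (EuclideanSpace ℝ (Fin 3)) → Fin K) (Kp : ℝ → ℝ → ℝ → ℝ)
    (S : Fin K → Option (Fin K) → Option (Fin K) → ℝ → ℝ → ℝ → ℝ)
    (hK : 0 ≤ ∑ x ∈ C, ∑ y ∈ C, Kp ⟪e, x⟫_ℝ ⟪e, y⟫_ℝ ⟪x, y⟫_ℝ)
    (hblock : ∀ x ∈ C, 0 ≤
      (∑ y ∈ C, ∑ z ∈ C, S (lab x) (some (lab y)) (some (lab z)) ⟪x, y⟫_ℝ ⟪x, z⟫_ℝ ⟪y, z⟫_ℝ)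
      + (∑ y ∈ C, S (lab x) (some (lab y)) none ⟪x, y⟫_ℝ (-⟪e, x⟫_ℝ) (-⟪e, y⟫_ℝ))
      + (∑ z ∈ C, S (lab x) none (some (lab z)) (-⟪e, x⟫_ℝ) ⟪x, z⟫_ℝ (-⟪e, z⟫_ℝ))
      + S (lab x) none none (-⟪e, x⟫_ℝ) (-⟪e, x⟫_ℝ) 1) :
    0 ≤ (∑ x ∈ C, readD Kp S (lab x) ⟪e, x⟫_ℝ)
      + (∑ x ∈ C, ∑ y ∈ C.erase x, readPh Kp S (lab x) (lab y) ⟪e, x⟫_ℝ ⟪e, y⟫_ℝ ⟪x, y⟫_ℝ)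
      + (∑ x ∈ C, ∑ y ∈ C.erase x, ∑ z ∈ (C.erase x).erase y,
          readT S (lab x) (lab y) (lab z) ⟪x, y⟫_ℝ ⟪x, z⟫_ℝ ⟪y, z⟫_ℝ) := by
  classical
  have hself : ∀ x ∈ C, ⟪x, x⟫_ℝ = (1 : ℝ) := fun x hx => by
    rw [real_inner_self_eq_norm_sq, hC x hx]; norm_num
  -- per-pole identity: the pole-`x` row of `hK` plus the pole-`x` block equals the readings
  have hx_id : ∀ x ∈ C,
      readD Kp S (lab x) ⟪e, x⟫_ℝ
        + (∑ y ∈ C.erase x, readPh Kp S (lab x) (lab y) ⟪e, x⟫_ℝ ⟪e, y⟫_ℝ ⟪x, y⟫_ℝ)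
        + (∑ y ∈ C.erase x, ∑ z ∈ (C.erase x).erase y,
            readT S (lab x) (lab y) (lab z) ⟪x, y⟫_ℝ ⟪x, z⟫_ℝ ⟪y, z⟫_ℝ)
      = (∑ y ∈ C, Kp ⟪e, x⟫_ℝ ⟪e, y⟫_ℝ ⟪x, y⟫_ℝ)
        + ((∑ y ∈ C, ∑ z ∈ C, S (lab x) (some (lab y)) (some (lab z)) ⟪x, y⟫_ℝ ⟪x, z⟫_ℝ ⟪y, z⟫_ℝ)
          + (∑ y ∈ C, S (lab x) (some (lab y)) none ⟪x, y⟫_ℝ (-⟪e, x⟫_ℝ) (-⟪e, y⟫_ℝ))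
          + (∑ z ∈ C, S (lab x) none (some (lab z)) (-⟪e, x⟫_ℝ) ⟪x, z⟫_ℝ (-⟪e, z⟫_ℝ))
          + S (lab x) none none (-⟪e, x⟫_ℝ) (-⟪e, x⟫_ℝ) 1) := by
    intro x hx
    -- erase-sums → full sums
    have d1 : (∑ y ∈ C.erase x, readPh Kp S (lab x) (lab y) ⟪e, x⟫_ℝ ⟪e, y⟫_ℝ ⟪x, y⟫_ℝ)
        = (∑ y ∈ C, readPh Kp S (lab x) (lab y) ⟪e, x⟫_ℝ ⟪e, y⟫_ℝ ⟪x, y⟫_ℝ)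
          - readPh Kp S (lab x) (lab x) ⟪e, x⟫_ℝ ⟪e, x⟫_ℝ ⟪x, x⟫_ℝ := Finset.sum_erase_eq_sub hx
    have d2 : (∑ y ∈ C.erase x, ∑ z ∈ (C.erase x).erase y,
            readT S (lab x) (lab y) (lab z) ⟪x, y⟫_ℝ ⟪x, z⟫_ℝ ⟪y, z⟫_ℝ)
        = (∑ y ∈ C, ((∑ z ∈ C, readT S (lab x) (lab y) (lab z) ⟪x, y⟫_ℝ ⟪x, z⟫_ℝ ⟪y, z⟫_ℝ)
              - readT S (lab x) (lab y) (lab x) ⟪x, y⟫_ℝ ⟪x, x⟫_ℝ ⟪y, x⟫_ℝ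
              - readT S (lab x) (lab y) (lab y) ⟪x, y⟫_ℝ ⟪x, y⟫_ℝ ⟪y, y⟫_ℝ))
          - ((∑ z ∈ C, readT S (lab x) (lab x) (lab z) ⟪x, x⟫_ℝ ⟪x, z⟫_ℝ ⟪x, z⟫_ℝ)
              - readT S (lab x) (lab x) (lab x) ⟪x, x⟫_ℝ ⟪x, x⟫_ℝ ⟪x, x⟫_ℝ
              - readT S (lab x) (lab x) (lab x) ⟪x, x⟫_ℝ ⟪x, x⟫_ℝ ⟪x, x⟫_ℝ) := by
      have inner' : ∀ y ∈ C.erase x, (∑ z ∈ (C.erase x).erase y,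
            readT S (lab x) (lab y) (lab z) ⟪x, y⟫_ℝ ⟪x, z⟫_ℝ ⟪y, z⟫_ℝ)
          = (∑ z ∈ C, readT S (lab x) (lab y) (lab z) ⟪x, y⟫_ℝ ⟪x, z⟫_ℝ ⟪y, z⟫_ℝ)
              - readT S (lab x) (lab y) (lab x) ⟪x, y⟫_ℝ ⟪x, x⟫_ℝ ⟪y, x⟫_ℝ
              - readT S (lab x) (lab y) (lab y) ⟪x, y⟫_ℝ ⟪x, y⟫_ℝ ⟪y, y⟫_ℝ := by
        intro y hy
        rw [Finset.sum_erase_eq_sub hy, Finset.sum_erase_eq_sub hx]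
      rw [Finset.sum_congr rfl inner', Finset.sum_erase_eq_sub hx]
    -- normalise ⟪y,y⟫ = 1 and ⟪y,x⟫ = ⟪x,y⟫ inside the y-sums
    have n1 : (∑ y ∈ C, ((∑ z ∈ C, readT S (lab x) (lab y) (lab z) ⟪x, y⟫_ℝ ⟪x, z⟫_ℝ ⟪y, z⟫_ℝ)
              - readT S (lab x) (lab y) (lab x) ⟪x, y⟫_ℝ ⟪x, x⟫_ℝ ⟪y, x⟫_ℝ
              - readT S (lab x) (lab y) (lab y) ⟪x, y⟫_ℝ ⟪x, y⟫_ℝ ⟪y, y⟫_ℝ))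
        = (∑ y ∈ C, ((∑ z ∈ C, readT S (lab x) (lab y) (lab z) ⟪x, y⟫_ℝ ⟪x, z⟫_ℝ ⟪y, z⟫_ℝ)
              - readT S (lab x) (lab y) (lab x) ⟪x, y⟫_ℝ 1 ⟪x, y⟫_ℝ
              - readT S (lab x) (lab y) (lab y) ⟪x, y⟫_ℝ ⟪x, y⟫_ℝ 1)) := by
      refine Finset.sum_congr rfl fun y hy => ?_
      rw [hself x hx, hself y hy, real_inner_comm x y]
    rw [d1, d2, n1, hself x hx]
    simp only [readD, readPh, readT, Finset.sum_add_distrib, Finset.sum_sub_distrib]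
    ring
  calc (0 : ℝ) ≤ (∑ x ∈ C, ∑ y ∈ C, Kp ⟪e, x⟫_ℝ ⟪e, y⟫_ℝ ⟪x, y⟫_ℝ)
        + ∑ x ∈ C, ((∑ y ∈ C, ∑ z ∈ C, S (lab x) (some (lab y)) (some (lab z)) ⟪x, y⟫_ℝ ⟪x, z⟫_ℝ ⟪y, z⟫_ℝ)
          + (∑ y ∈ C, S (lab x) (some (lab y)) none ⟪x, y⟫_ℝ (-⟪e, x⟫_ℝ) (-⟪e, y⟫_ℝ))
          + (∑ z ∈ C, S (lab x) none (some (lab z)) (-⟪e, x⟫_ℝ) ⟪x, z⟫_ℝ (-⟪e, z⟫_ℝ))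
          + S (lab x) none none (-⟪e, x⟫_ℝ) (-⟪e, x⟫_ℝ) 1) :=
        add_nonneg hK (Finset.sum_nonneg hblock)
    _ = ∑ x ∈ C, (readD Kp S (lab x) ⟪e, x⟫_ℝ
        + (∑ y ∈ C.erase x, readPh Kp S (lab x) (lab y) ⟪e, x⟫_ℝ ⟪e, y⟫_ℝ ⟪x, y⟫_ℝ)
        + (∑ y ∈ C.erase x, ∑ z ∈ (C.erase x).erase y,
            readT S (lab x) (lab y) (lab z) ⟪x, y⟫_ℝ ⟪x, z⟫_ℝ ⟪y, z⟫_ℝ)) := by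
        rw [← Finset.sum_add_distrib]
        exact Finset.sum_congr rfl fun x hx => (hx_id x hx).symm
    _ = _ := by rw [Finset.sum_add_distrib, Finset.sum_add_distrib]

/-- **(C) Multiplicity arithmetic, pairs** (pure combinatorics): with `n b = #(C ∩ lab⁻¹ b)`,
`Σ_{x≠y} c (lab x) (lab y) = Σ_p Σ_q (n p * n q - [p = q] n p) * c p q`. -/
theorem pair_multiplicity (C : Finset (EuclideanSpace ℝ (Fin 3))) (lab : (EuclideanSpace ℝ (Fin 3)) → Fin K) (c : Fin K → Fin K → ℝ) :
    (∑ x ∈ C, ∑ y ∈ C.erase x, c (lab x) (lab y))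
      = ∑ p : Fin K, ∑ q : Fin K,
          (((C.filter fun x => lab x = p).card : ℝ) * ((C.filter fun x => lab x = q).card : ℝ)
            - (if p = q then ((C.filter fun x => lab x = p).card : ℝ) else 0)) * c p q := by
  classical
  set n : Fin K → ℝ := fun p => ((C.filter fun x => lab x = p).card : ℝ) with hn
  have fib : ∀ F : Fin K → ℝ, (∑ x ∈ C, F (lab x)) = ∑ p, n p * F p := by
    intro F
    rw [← Finset.sum_fiberwise_of_maps_to (s := C) (t := Finset.univ) (g := lab)
      (f := fun x => F (lab x)) (fun x _ => Finset.mem_univ (lab x))]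
    refine Finset.sum_congr rfl fun p _ => ?_
    have hc : ∀ x ∈ C.filter (fun x => lab x = p), F (lab x) = F p := fun x hx => by
      rw [(Finset.mem_filter.mp hx).2]
    rw [Finset.sum_congr rfl hc, Finset.sum_const, nsmul_eq_mul]
  have l1 : (∑ x ∈ C, ∑ y ∈ C.erase x, c (lab x) (lab y))
      = (∑ x ∈ C, ∑ y ∈ C, c (lab x) (lab y)) - ∑ x ∈ C, c (lab x) (lab x) := by
    rw [← Finset.sum_sub_distrib]
    exact Finset.sum_congr rfl fun x hx => Finset.sum_erase_eq_sub hx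
  have l2 : (∑ x ∈ C, ∑ y ∈ C, c (lab x) (lab y)) = ∑ p, n p * ∑ q, n q * c p q := by
    have inner : ∀ x ∈ C, (∑ y ∈ C, c (lab x) (lab y)) = ∑ q, n q * c (lab x) q :=
      fun x _ => fib (c (lab x))
    rw [Finset.sum_congr rfl inner]
    exact fib (fun p => ∑ q, n q * c p q)
  have l3 : (∑ x ∈ C, c (lab x) (lab x)) = ∑ p, n p * c p p := fib (fun p => c p p)
  have r1 : ∀ p : Fin K, (∑ q : Fin K, (n p * n q - (if p = q then n p else 0)) * c p q)
      = n p * (∑ q, n q * c p q) - n p * c p p := by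
    intro p
    have e1 : ∀ q : Fin K, (n p * n q - (if p = q then n p else 0)) * c p q
        = n p * (n q * c p q) - (if p = q then n p * c p q else 0) := by
      intro q; split_ifs <;> ring
    rw [Finset.sum_congr rfl (fun q _ => e1 q), Finset.sum_sub_distrib, Finset.sum_ite_eq,
      ← Finset.mul_sum]
    simp
  rw [l1, l2, l3, Finset.sum_congr rfl (fun p _ => r1 p), Finset.sum_sub_distrib]

/-- Reindexing helper (copy of CapX2Sound's private `sum2_sum2_comm`). -/
private theorem bsum2_sum2_comm {α β : Type*} (s : Finset α) (t : Finset β) (K R : ℕ)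
    (f : α → β → ℕ → ℕ → ℝ) :
    (∑ y ∈ s, ∑ z ∈ t, ∑ k ∈ range K, ∑ r ∈ range R, f y z k r) =
      ∑ k ∈ range K, ∑ r ∈ range R, ∑ y ∈ s, ∑ z ∈ t, f y z k r := by
  calc (∑ y ∈ s, ∑ z ∈ t, ∑ k ∈ range K, ∑ r ∈ range R, f y z k r)
      = ∑ y ∈ s, ∑ k ∈ range K, ∑ z ∈ t, ∑ r ∈ range R, f y z k r :=
        sum_congr rfl fun _ _ => sum_comm
    _ = ∑ y ∈ s, ∑ k ∈ range K, ∑ r ∈ range R, ∑ z ∈ t, f y z k r :=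
        sum_congr rfl fun _ _ => sum_congr rfl fun _ _ => sum_comm
    _ = ∑ k ∈ range K, ∑ y ∈ s, ∑ r ∈ range R, ∑ z ∈ t, f y z k r := sum_comm
    _ = ∑ k ∈ range K, ∑ r ∈ range R, ∑ y ∈ s, ∑ z ∈ t, f y z k r :=
        sum_congr rfl fun _ _ => sum_comm

/-- Reindexing helper (copy of CapX2Sound's private `sum_sum2_comm`). -/
private theorem bsum_sum2_comm {α : Type*} (s : Finset α) (K R : ℕ) (f : α → ℕ → ℕ → ℝ) :
    (∑ y ∈ s, ∑ k ∈ range K, ∑ r ∈ range R, f y k r) =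
      ∑ k ∈ range K, ∑ r ∈ range R, ∑ y ∈ s, f y k r := by
  calc (∑ y ∈ s, ∑ k ∈ range K, ∑ r ∈ range R, f y k r)
      = ∑ k ∈ range K, ∑ y ∈ s, ∑ r ∈ range R, f y k r := sum_comm
    _ = ∑ k ∈ range K, ∑ r ∈ range R, ∑ y ∈ s, f y k r := sum_congr rfl fun _ _ => sum_comm

/-! ## Banded pole-block positivity (discharges `hblock` of `banded_accounting` for factored PSD data)

The families are FACTORED pole kernels `poleKernel3 Kq R (a b β) (a b β')` (CapX2Sound): for the pole
band `b`, block `β : Option (Fin K)` (`none` = hole-centre column), `a b β k r : ℝ → ℝ` is the `r`-th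
factor column of the PSD block `G^b_k` restricted to the feature functions of block `β`.  The proof is
CapX2Sound's `poleBlock_nonneg` with the weight of a code point `y` read from ITS OWN label — the
Bachoc–Vallentin inequality `sum_sum_Q3_nonneg` takes arbitrary real weights, so labels cost nothing. -/

open Literature.Geometry.DiscreteGeometry Literature.Geometry.DiscreteGeometry.BachocVallentin
  Summit.Ventures.Crystal3D.CapX2 in
/-- **Banded pole-block positivity** (discharges `hblock` of `banded_accounting` for FACTORED PSD data): for the
pole `x`, the hole centre `p` and families `poleKernel3 Kq R (a β) (a β')` whose weight for a code point `y` is read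
from ITS OWN label `lab y` (block `none` = the column of `p`), the aggregated block is `≥ 0` — CapX2Sound's
`poleKernel3`/`poleBlock_nonneg` argument on `insertNone C` (`sum_sum_Q3_nonneg` takes arbitrary real weights). -/
theorem banded_poleBlock_nonneg (Kq R : ℕ) (a : Option (Fin K) → ℕ → ℕ → ℝ → ℝ)
    (x p : EuclideanSpace ℝ (Fin 3)) (hx : ‖x‖ = 1) (hp : ‖p‖ = 1)
    (C : Finset (EuclideanSpace ℝ (Fin 3))) (hC : ∀ y ∈ C, ‖y‖ = 1) (lab : EuclideanSpace ℝ (Fin 3) → Fin K) :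
    0 ≤ (∑ y ∈ C, ∑ z ∈ C, poleKernel3 Kq R (a (some (lab y))) (a (some (lab z))) ⟪x, y⟫_ℝ ⟪x, z⟫_ℝ ⟪y, z⟫_ℝ)
      + (∑ y ∈ C, poleKernel3 Kq R (a (some (lab y))) (a none) ⟪x, y⟫_ℝ ⟪x, p⟫_ℝ ⟪y, p⟫_ℝ)
      + (∑ z ∈ C, poleKernel3 Kq R (a none) (a (some (lab z))) ⟪x, p⟫_ℝ ⟪x, z⟫_ℝ ⟪p, z⟫_ℝ)
      + poleKernel3 Kq R (a none) (a none) ⟪x, p⟫_ℝ ⟪x, p⟫_ℝ 1 := by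
  classical
  have hpp : ⟪p, p⟫_ℝ = 1 := by rw [real_inner_self_eq_norm_sq, hp]; norm_num
  -- one `(k, r)` at a time: the fixed-pole `Q3` inequality on `insertNone C` with label-dependent weights
  have hkr : ∀ k r : ℕ, 0 ≤
      (∑ y ∈ C, ∑ z ∈ C, a (some (lab y)) k r ⟪x, y⟫_ℝ * a (some (lab z)) k r ⟪x, z⟫_ℝ
          * Q3 k ⟪x, y⟫_ℝ ⟪x, z⟫_ℝ ⟪y, z⟫_ℝ)
      + (∑ y ∈ C, a (some (lab y)) k r ⟪x, y⟫_ℝ * a none k r ⟪x, p⟫_ℝ * Q3 k ⟪x, y⟫_ℝ ⟪x, p⟫_ℝ ⟪y, p⟫_ℝ)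
      + (∑ z ∈ C, a none k r ⟪x, p⟫_ℝ * a (some (lab z)) k r ⟪x, z⟫_ℝ * Q3 k ⟪x, p⟫_ℝ ⟪x, z⟫_ℝ ⟪p, z⟫_ℝ)
      + a none k r ⟪x, p⟫_ℝ * a none k r ⟪x, p⟫_ℝ * Q3 k ⟪x, p⟫_ℝ ⟪x, p⟫_ℝ 1 := by
    intro k r
    have key := sum_sum_Q3_nonneg k x hx (insertNone C)
      (fun o => o.elim (a none k r ⟪x, p⟫_ℝ) (fun y => a (some (lab y)) k r ⟪x, y⟫_ℝ))
      (fun o => o.elim p id)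
      (by
        intro o ho
        cases o with
        | none => exact hp
        | some y => exact hC y (by simpa using ho))
    simp only [sum_insertNone, Option.elim, id, hpp] at key
    rw [sum_add_distrib] at key
    linarith
  have htot : 0 ≤ ∑ k ∈ range Kq, ∑ r ∈ range R,
      ((∑ y ∈ C, ∑ z ∈ C, a (some (lab y)) k r ⟪x, y⟫_ℝ * a (some (lab z)) k r ⟪x, z⟫_ℝ
          * Q3 k ⟪x, y⟫_ℝ ⟪x, z⟫_ℝ ⟪y, z⟫_ℝ)
      + (∑ y ∈ C, a (some (lab y)) k r ⟪x, y⟫_ℝ * a none k r ⟪x, p⟫_ℝ * Q3 k ⟪x, y⟫_ℝ ⟪x, p⟫_ℝ ⟪y, p⟫_ℝ)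
      + (∑ z ∈ C, a none k r ⟪x, p⟫_ℝ * a (some (lab z)) k r ⟪x, z⟫_ℝ * Q3 k ⟪x, p⟫_ℝ ⟪x, z⟫_ℝ ⟪p, z⟫_ℝ)
      + a none k r ⟪x, p⟫_ℝ * a none k r ⟪x, p⟫_ℝ * Q3 k ⟪x, p⟫_ℝ ⟪x, p⟫_ℝ 1) :=
    sum_nonneg fun k _ => sum_nonneg fun r _ => hkr k r
  -- reindex the `(k, r)` sums to the outside of each block term
  have e1 : (∑ y ∈ C, ∑ z ∈ C, poleKernel3 Kq R (a (some (lab y))) (a (some (lab z))) ⟪x, y⟫_ℝ ⟪x, z⟫_ℝ ⟪y, z⟫_ℝ)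
      = ∑ k ∈ range Kq, ∑ r ∈ range R, ∑ y ∈ C, ∑ z ∈ C,
          a (some (lab y)) k r ⟪x, y⟫_ℝ * a (some (lab z)) k r ⟪x, z⟫_ℝ * Q3 k ⟪x, y⟫_ℝ ⟪x, z⟫_ℝ ⟪y, z⟫_ℝ := by
    unfold poleKernel3; exact bsum2_sum2_comm C C Kq R _
  have e2 : (∑ y ∈ C, poleKernel3 Kq R (a (some (lab y))) (a none) ⟪x, y⟫_ℝ ⟪x, p⟫_ℝ ⟪y, p⟫_ℝ)
      = ∑ k ∈ range Kq, ∑ r ∈ range R, ∑ y ∈ C,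
          a (some (lab y)) k r ⟪x, y⟫_ℝ * a none k r ⟪x, p⟫_ℝ * Q3 k ⟪x, y⟫_ℝ ⟪x, p⟫_ℝ ⟪y, p⟫_ℝ := by
    unfold poleKernel3; exact bsum_sum2_comm C Kq R _
  have e3 : (∑ z ∈ C, poleKernel3 Kq R (a none) (a (some (lab z))) ⟪x, p⟫_ℝ ⟪x, z⟫_ℝ ⟪p, z⟫_ℝ)
      = ∑ k ∈ range Kq, ∑ r ∈ range R, ∑ z ∈ C,
          a none k r ⟪x, p⟫_ℝ * a (some (lab z)) k r ⟪x, z⟫_ℝ * Q3 k ⟪x, p⟫_ℝ ⟪x, z⟫_ℝ ⟪p, z⟫_ℝ := by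
    unfold poleKernel3; exact bsum_sum2_comm C Kq R _
  rw [e1, e2, e3]
  unfold poleKernel3
  simpa only [sum_add_distrib] using htot

/-- **Banded accounting for FACTORED data (hypothesis-free positivity).**  With the cap kernel
`capKernel3 Kc Rc g` (BV09, one family) and banded pole families
`S b β β' := poleKernel3 Kq R (a b β) (a b β')` (one factored PSD block set per POLE band `b`), for
`p = -e` the readings satisfy `0 ≤ Σ D + Σ_{x≠y} Ph + Σ_{distinct} T` for EVERY labelling `lab`. -/
theorem banded_accounting_factored (Kc Rc Kq R : ℕ) (g : ℕ → ℕ → ℝ → ℝ)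
    (a : Fin K → Option (Fin K) → ℕ → ℕ → ℝ → ℝ)
    (e : EuclideanSpace ℝ (Fin 3)) (he : ‖e‖ = 1)
    (C : Finset (EuclideanSpace ℝ (Fin 3))) (hC : ∀ x ∈ C, ‖x‖ = 1)
    (lab : EuclideanSpace ℝ (Fin 3) → Fin K) :
    0 ≤ (∑ x ∈ C, readD (Literature.Geometry.DiscreteGeometry.BachocVallentin.capKernel3 Kc Rc g)
          (fun b β β' => Summit.Ventures.Crystal3D.CapX2.poleKernel3 Kq R (a b β) (a b β')) (lab x) ⟪e, x⟫_ℝ)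
      + (∑ x ∈ C, ∑ y ∈ C.erase x,
          readPh (Literature.Geometry.DiscreteGeometry.BachocVallentin.capKernel3 Kc Rc g)
            (fun b β β' => Summit.Ventures.Crystal3D.CapX2.poleKernel3 Kq R (a b β) (a b β'))
            (lab x) (lab y) ⟪e, x⟫_ℝ ⟪e, y⟫_ℝ ⟪x, y⟫_ℝ)
      + (∑ x ∈ C, ∑ y ∈ C.erase x, ∑ z ∈ (C.erase x).erase y,
          readT (fun b β β' => Summit.Ventures.Crystal3D.CapX2.poleKernel3 Kq R (a b β) (a b β'))
            (lab x) (lab y) (lab z) ⟪x, y⟫_ℝ ⟪x, z⟫_ℝ ⟪y, z⟫_ℝ) := by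
  refine banded_accounting e C hC lab _ _ ?_ ?_
  · exact Literature.Geometry.DiscreteGeometry.BachocVallentin.sum_sum_capKernel3_nonneg Kc Rc g e he C hC
  · intro x hx
    have h := banded_poleBlock_nonneg (K := K) Kq R (a (lab x)) x (-e) (hC x hx) (by rw [norm_neg, he]) C hC lab
    have hneg : ∀ y : EuclideanSpace ℝ (Fin 3), ⟪y, -e⟫_ℝ = -⟪e, y⟫_ℝ := fun y => by
      rw [inner_neg_right, real_inner_comm]
    have hneg' : ∀ y : EuclideanSpace ℝ (Fin 3), ⟪-e, y⟫_ℝ = -⟪e, y⟫_ℝ := fun y => by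
      rw [inner_neg_left]
    simp only [hneg, hneg'] at h
    simpa [add_assoc] using h

end Summit.Ventures.Crystal3D.BandedSpec
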